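import Mathlib
import Summits.QuantumFields.YangMills.Theorems.TransportFieldVacuumDerivativeLinear
import Summits.QuantumFields.YangMills.Theorems.FemtoTransferGapSlabFlowLift
import HarnessLib

/-!
# Crux `CovariantCurrentDoor.CurrentCommutatorCeiling` ⟨stmt-QuantumFields-23379⟩, line `birth` (planner ym-idea-4 g17, v2 sha16 09276c0f):
# the registered stub `stub_cauchySchwarzCommutator` — CLOSED, via the transport-field regularity kit

`CauchySchwarzCommutatorP`: for the covariant current `X = Σ_x ∂/∂t|₀ (· ∘ U[(x,0) ↦ U_{(x,0)} expPauli(t b_{x+ê₀}(U))])` built on the smoothed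
colour-electric field `B = T^{L²(⌈log β⌉+1)}M₀`, the one-step deficit of `ψ = XΩ` satisfies
`λ₀‖ψ‖² − ⟨ψ, K_βψ⟩ ≤ ‖ψ‖ · ‖X(K_βΩ) − K_β(XΩ)‖`.
Proof: `K_βΩ = λ₀Ω` gives `X(K_βΩ) = λ₀ψ` (the `deriv` of a constant multiple), so the commutator state is `g = λ₀ψ − K_βψ` and the deficit is
`⟨ψ, g⟩ ≤ ‖ψ‖‖g‖` by Cauchy–Schwarz — which is a genuine `L²` statement only because `ψ` is square-integrable: by the regularity kit
(`TransportField.continuous_deriv_vacuum_rightShift`, tranches 1–3b) `ψ` is CONTINUOUS on the compact configuration space once the direction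
field `U ↦ b_s(U)` is, and the latter is an iterate of the continuous covariant smoothing `T_U` applied to the continuous `M₀(U)` (§1).
HONEST FRAMING: the crux (its amplitude and commutator-norm stubs) is OPEN; K2a and the YM mass gap are NOT proved.  No `sorry`, no new axiom;
the `abbrev` is a registered-stub copy (verbatim), not a citable fact.  References: [cite: ReedSimonIV1978, Thm. XIII.43]; [cite: Balaban1985UV3, p. 260].
-/

set_option autoImplicit false

noncomputable section

open MeasureTheory Filter Topology
open scoped BigOperators
open Literature.MathematicalPhysics.QuantumFieldTheory (GaugeConfig Site Edge)
open Literature.MathematicalPhysics.QuantumLattice (secondCountableTopology_su2)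
open Literature.MathematicalPhysics.QuantumFieldTheory.Balaban1983to89.B10Eq18SigmaSU2 (pauli)
open Literature.MathematicalPhysics.QuantumFieldTheory.Balaban1983to89.B10Eq18SigmaSU2Haar (expPauli)
open Summit.QuantumFields.YangMills.Theorems.EquipartitionPinsProbe.TangentSteinFiniteBeta (exists_abs_le_of_continuous)

namespace Summit.QuantumFields.YangMills.Theorems.CovariantCurrentDoor

open Summit.QuantumFields.YangMills.Theorems.FemtoTransferGap
open Summit.QuantumFields.YangMills.Theorems.TransportField

variable {L : ℕ} [NeZero L]

/-! ## §1 Continuity of the smoothed colour-electric field and of its colour vector -/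

omit [NeZero L] in
/-- The seed field `M₀(U)_s = Re tr P₁(s) · ½(P₁(s) − P₁(s)⁻¹)` is continuous. [folklore] -/
theorem continuous_seedField :
    Continuous fun U : GaugeConfig 3 L SU2 => fun s : Site 3 L =>
      ((su2Rep (polyakovSite s U ((0 : Site 3 1), (1 : Fin 3)))).trace.re : ℂ) •
        ((1 / 2 : ℂ) • (su2Rep (polyakovSite s U ((0 : Site 3 1), (1 : Fin 3))) -
          su2Rep (polyakovSite s U ((0 : Site 3 1), (1 : Fin 3)))⁻¹)) := by
  refine continuous_pi fun s => ?_
  have hP : Continuous fun U : GaugeConfig 3 L SU2 => polyakovSite s U ((0 : Site 3 1), (1 : Fin 3)) := by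
    have h := continuous_polyakovSite (G := SU2) (L := L) s
    exact (continuous_apply (((0 : Site 3 1), (1 : Fin 3)) : Edge 3 1)).comp h
  have h1 : Continuous fun U : GaugeConfig 3 L SU2 => su2Rep (polyakovSite s U ((0 : Site 3 1), (1 : Fin 3))) :=
    continuous_su2Rep.comp hP
  have h2 : Continuous fun U : GaugeConfig 3 L SU2 => su2Rep (polyakovSite s U ((0 : Site 3 1), (1 : Fin 3)))⁻¹ :=
    continuous_su2Rep.comp hP.inv
  have hre : Continuous fun U : GaugeConfig 3 L SU2 => ((su2Rep (polyakovSite s U ((0 : Site 3 1), (1 : Fin 3)))).trace.re : ℂ) :=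
    Complex.continuous_ofReal.comp (Complex.continuous_re.comp h1.matrix_trace)
  have h3 : Continuous fun U : GaugeConfig 3 L SU2 => su2Rep (polyakovSite s U ((0 : Site 3 1), (1 : Fin 3))) -
      su2Rep (polyakovSite s U ((0 : Site 3 1), (1 : Fin 3)))⁻¹ := h1.sub h2
  have h4 : Continuous fun U : GaugeConfig 3 L SU2 => (1 / 2 : ℂ) • (su2Rep (polyakovSite s U ((0 : Site 3 1), (1 : Fin 3))) -
      su2Rep (polyakovSite s U ((0 : Site 3 1), (1 : Fin 3)))⁻¹) := h3.const_smul (1 / 2 : ℂ)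
  exact hre.smul h4

omit [NeZero L] in
/-- One covariant smoothing step `m ↦ T_U m` is jointly continuous in `(U, m)` along a continuous field `m = F(U)`. [folklore] -/
theorem continuous_smoothStep {F : GaugeConfig 3 L SU2 → Site 3 L → Matrix (Fin 2) (Fin 2) ℂ} (hF : Continuous F) :
    Continuous fun U : GaugeConfig 3 L SU2 => fun s : Site 3 L =>
      (1 / 5 : ℂ) • (F U s + ∑ i ∈ ({1, 2} : Finset (Fin 3)),
        (su2Rep (U (s, i)) * F U (s.shift i) * su2Rep (U (s, i))⁻¹ +
          su2Rep (U (s - Pi.single i 1, i))⁻¹ * F U (s - Pi.single i 1) * su2Rep (U (s - Pi.single i 1, i)))) := by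
  refine continuous_pi fun s => ?_
  have hev : ∀ y : Site 3 L, Continuous fun U : GaugeConfig 3 L SU2 => F U y := fun y => (continuous_apply y).comp hF
  have hd : ∀ ℓ : Edge 3 L, Continuous fun U : GaugeConfig 3 L SU2 => su2Rep (U ℓ) := fun ℓ => continuous_su2Rep.comp (continuous_apply ℓ)
  have hi : ∀ ℓ : Edge 3 L, Continuous fun U : GaugeConfig 3 L SU2 => su2Rep (U ℓ)⁻¹ :=
    fun ℓ => continuous_su2Rep.comp (continuous_apply ℓ).inv
  have hsum : Continuous fun U : GaugeConfig 3 L SU2 => F U s + ∑ i ∈ ({1, 2} : Finset (Fin 3)),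
      (su2Rep (U (s, i)) * F U (s.shift i) * su2Rep (U (s, i))⁻¹ +
        su2Rep (U (s - Pi.single i 1, i))⁻¹ * F U (s - Pi.single i 1) * su2Rep (U (s - Pi.single i 1, i))) := by
    refine (hev s).add (continuous_finsetSum _ fun i _ => ?_)
    exact (((hd _).mul (hev _)).mul (hi _)).add (((hi _).mul (hev _)).mul (hd _))
  exact hsum.const_smul (1 / 5 : ℂ)

omit [NeZero L] in
/-- **The smoothed field `B(U) = T_U^{[n]} M₀(U)` is continuous** (induction on `n`). [folklore] -/
theorem continuous_smoothedField (n : ℕ) :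
    Continuous fun U : GaugeConfig 3 L SU2 =>
      (fun m : Site 3 L → Matrix (Fin 2) (Fin 2) ℂ => fun s : Site 3 L =>
        (1 / 5 : ℂ) • (m s + ∑ i ∈ ({1, 2} : Finset (Fin 3)),
          (su2Rep (U (s, i)) * m (s.shift i) * su2Rep (U (s, i))⁻¹ +
            su2Rep (U (s - Pi.single i 1, i))⁻¹ * m (s - Pi.single i 1) * su2Rep (U (s - Pi.single i 1, i)))))^[n]
      (fun s : Site 3 L =>
        ((su2Rep (polyakovSite s U ((0 : Site 3 1), (1 : Fin 3)))).trace.re : ℂ) •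
          ((1 / 2 : ℂ) • (su2Rep (polyakovSite s U ((0 : Site 3 1), (1 : Fin 3))) -
            su2Rep (polyakovSite s U ((0 : Site 3 1), (1 : Fin 3)))⁻¹))) := by
  induction n with
  | zero => simpa only [Function.iterate_zero, id_eq] using continuous_seedField (L := L)
  | succ n ih =>
    simp only [Function.iterate_succ_apply']
    exact continuous_smoothStep ih

omit [NeZero L] in
/-- The colour vector `a ↦ Re(−i/2 · tr(σ_a M))` of a continuous matrix field is continuous. [folklore] -/
theorem continuous_colourOf {M : GaugeConfig 3 L SU2 → Matrix (Fin 2) (Fin 2) ℂ} (hM : Continuous M) :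
    Continuous fun U : GaugeConfig 3 L SU2 =>
      (EuclideanSpace.equiv (Fin 3) ℝ).symm fun a => (-(Complex.I / 2) * (pauli a * M U).trace).re := by
  refine (EuclideanSpace.equiv (Fin 3) ℝ).symm.continuous.comp (continuous_pi fun a => ?_)
  exact Complex.continuous_re.comp (continuous_const.mul (continuous_const.mul hM).matrix_trace)

/-! ## §2 `L²` algebra for bounded continuous functions -/

/-- `K_βψ` is continuous for continuous `ψ` (dominated convergence, jointly continuous bounded kernel). [folklore] -/
theorem continuous_transferApply_of_continuous (β : ℝ) {ψ : GaugeConfig 3 L SU2 → ℝ} (hψ : Continuous ψ) :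
    Continuous (transferApply β ψ) := by
  haveI : SecondCountableTopology SU2 := secondCountableTopology_su2
  haveI : IsProbabilityMeasure (configMeasure SU2 L) := by unfold configMeasure; infer_instance
  have hK := continuous_transferKernel su2Rep (L := L) continuous_su2Rep β
  obtain ⟨CK, hCK0, hCK⟩ := exists_abs_le_of_continuous hK
  obtain ⟨Cψ, -, hCψ⟩ := exists_abs_le_of_continuous hψ
  have hKr : ∀ U : GaugeConfig 3 L SU2, Continuous fun V => transferKernel su2Rep β U V := fun U => by
    have h := hK.comp (Continuous.prodMk_right U); exact h
  have hKl : ∀ V : GaugeConfig 3 L SU2, Continuous fun U => transferKernel su2Rep β U V := fun V => by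
    have h := hK.comp (Continuous.prodMk_left V); exact h
  unfold transferApply
  refine continuous_of_dominated (bound := fun _ => CK * Cψ) (fun U => ((hKr U).mul hψ).measurable.aestronglyMeasurable)
    (fun U => ae_of_all _ fun V => ?_) (integrable_const _) (ae_of_all _ fun V => (hKl V).mul continuous_const)
  rw [Real.norm_eq_abs, abs_mul]
  exact mul_le_mul (hCK (U, V)) (hCψ V) (abs_nonneg _) hCK0

/-- Integrability of a product of continuous functions on the compact configuration space. [folklore] -/
theorem integrable_mul_of_continuous {f g : GaugeConfig 3 L SU2 → ℝ} (hf : Continuous f) (hg : Continuous g) :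
    Integrable (fun U => f U * g U) (configMeasure SU2 L) := by
  haveI : SecondCountableTopology SU2 := secondCountableTopology_su2
  haveI : IsProbabilityMeasure (configMeasure SU2 L) := by unfold configMeasure; infer_instance
  obtain ⟨Cf, -, hCf⟩ := exists_abs_le_of_continuous hf
  obtain ⟨Cg, -, hCg⟩ := exists_abs_le_of_continuous hg
  refine Integrable.of_bound (hf.mul hg).measurable.aestronglyMeasurable (Cf * Cg) (ae_of_all _ fun U => ?_)
  rw [Real.norm_eq_abs, abs_mul]
  exact mul_le_mul (hCf U) (hCg U) (abs_nonneg _) ((abs_nonneg _).trans (hCf U))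

/-- **Cauchy–Schwarz for continuous functions**: `⟨f, g⟩ ≤ √⟨f,f⟩ √⟨g,g⟩` (discriminant of `t ↦ ‖f − tg‖²`). [folklore] -/
theorem l2_le_sqrt_mul_sqrt_of_continuous {f g : GaugeConfig 3 L SU2 → ℝ} (hf : Continuous f) (hg : Continuous g) :
    l2 f g ≤ Real.sqrt (l2 f f) * Real.sqrt (l2 g g) := by
  have hff := integrable_mul_of_continuous hf hf
  have hgg := integrable_mul_of_continuous hg hg
  have hfg := integrable_mul_of_continuous hf hg
  -- `0 ≤ ⟨g,g⟩ t² − 2⟨f,g⟩ t + ⟨f,f⟩`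
  have hquad : ∀ t : ℝ, 0 ≤ l2 g g * (t * t) + (-(2 * l2 f g)) * t + l2 f f := by
    intro t
    have h0 : 0 ≤ ∫ U, (f U - t * g U) * (f U - t * g U) ∂configMeasure SU2 L :=
      integral_nonneg fun U => mul_self_nonneg _
    have hexp : ∫ U, (f U - t * g U) * (f U - t * g U) ∂configMeasure SU2 L =
        l2 g g * (t * t) + (-(2 * l2 f g)) * t + l2 f f := by
      have hpt : (fun U => (f U - t * g U) * (f U - t * g U)) =
          fun U => (t * t) * (g U * g U) + (-(2 * t)) * (f U * g U) + f U * f U := by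
        funext U; ring
      have i1 : Integrable (fun U => t * t * (g U * g U)) (configMeasure SU2 L) := hgg.const_mul _
      have i2 : Integrable (fun U => -(2 * t) * (f U * g U)) (configMeasure SU2 L) := hfg.const_mul _
      have i12 : Integrable (fun U => t * t * (g U * g U) + -(2 * t) * (f U * g U)) (configMeasure SU2 L) := i1.add i2
      rw [hpt, integral_add i12 hff, integral_add i1 i2, integral_const_mul, integral_const_mul]
      unfold l2
      ring
    rw [← hexp]; exact h0
  have hdisc := discrim_le_zero hquad
  rw [discrim] at hdisc
  have hsq : l2 f g ^ 2 ≤ l2 f f * l2 g g := by nlinarith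
  have hf0 : 0 ≤ l2 f f := integral_nonneg fun _ => mul_self_nonneg _
  have hg0 : 0 ≤ l2 g g := integral_nonneg fun _ => mul_self_nonneg _
  calc l2 f g ≤ |l2 f g| := le_abs_self _
    _ = Real.sqrt (l2 f g ^ 2) := (Real.sqrt_sq_eq_abs _).symm
    _ ≤ Real.sqrt (l2 f f * l2 g g) := Real.sqrt_le_sqrt hsq
    _ = Real.sqrt (l2 f f) * Real.sqrt (l2 g g) := Real.sqrt_mul hf0 _

/-! ## §3 The registered stub -/

/-- The registered stub statement `CauchySchwarzCommutatorP` of line `birth` (v2) of crux ⟨stmt-QuantumFields-23379⟩ (verbatim copy of the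
skeleton's `BirthCCC.CauchySchwarzCommutatorP`; a registered-stub copy, not a citable fact). -/
abbrev CauchySchwarzCommutatorP : Prop :=
  ∀ β : ℝ, 0 < β → ∀ (L : ℕ) [NeZero L], ∀ Ω : Literature.MathematicalPhysics.QuantumFieldTheory.GaugeConfig 3 L SU2 → ℝ, IsPhys Ω → l2 Ω Ω = 1 → transferApply β Ω = topValue su2Rep L β • Ω → let P : Literature.MathematicalPhysics.QuantumFieldTheory.Site 3 L → Literature.MathematicalPhysics.QuantumFieldTheory.GaugeConfig 3 L SU2 → SU2 := fun s U => polyakovSite s U ((0 : Literature.MathematicalPhysics.QuantumFieldTheory.Site 3 1), (1 : Fin 3)); let M₀ : Literature.MathematicalPhysics.QuantumFieldTheory.GaugeConfig 3 L SU2 → Literature.MathematicalPhysics.QuantumFieldTheory.Site 3 L → Matrix (Fin 2) (Fin 2) ℂ := fun U s => ((su2Rep (P s U)).trace.re : ℂ) • ((1 / 2 : ℂ) • (su2Rep (P s U) - su2Rep (P s U)⁻¹)); let T : Literature.MathematicalPhysics.QuantumFieldTheory.GaugeConfig 3 L SU2 → (Literature.MathematicalPhysics.QuantumFieldTheory.Site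 3 L → Matrix (Fin 2) (Fin 2) ℂ) → Literature.MathematicalPhysics.QuantumFieldTheory.Site 3 L → Matrix (Fin 2) (Fin 2) ℂ := fun U m s => (1 / 5 : ℂ) • (m s + ∑ i ∈ ({1, 2} : Finset (Fin 3)), (su2Rep (U (s, i)) * m (s.shift i) * su2Rep (U (s, i))⁻¹ + su2Rep (U (s - Pi.single i 1, i))⁻¹ * m (s - Pi.single i 1) * su2Rep (U (s - Pi.single i 1, i)))); let B : Literature.MathematicalPhysics.QuantumFieldTheory.GaugeConfig 3 L SU2 → Literature.MathematicalPhysics.QuantumFieldTheory.Site 3 L → Matrix (Fin 2) (Fin 2) ℂ := fun U => (T U)^[L ^ 2 * (⌈Real.log β⌉₊ + 1)] (M₀ U); let b : Literature.MathematicalPhysics.QuantumFieldTheory.Site 3 L → Literature.MathematicalPhysics.QuantumFieldTheory.GaugeConfig 3 L SU2 → EuclideanSpace ℝ (Fin 3) := fun s U => (EuclideanSpace.equiv (Fin 3) ℝ).symm fun a => (-(Complex.I / 2) * (Literature.MathematicalPhysics.QuantumFieldTheory.Balaban1983to89.B10Eq18SigmaSU2.pauli a * B U s).trace).re; let X : (Literature.MathematicalPhysics.QuantumFieldTheory.GaugeConfig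 3 L SU2 → ℝ) → Literature.MathematicalPhysics.QuantumFieldTheory.GaugeConfig 3 L SU2 → ℝ := fun ψ U => ∑ x : Literature.MathematicalPhysics.QuantumFieldTheory.Site 3 L, deriv (fun t : ℝ => ψ (Function.update U (x, (0 : Fin 3)) (U (x, (0 : Fin 3)) * Literature.MathematicalPhysics.QuantumFieldTheory.Balaban1983to89.B10Eq18SigmaSU2Haar.expPauli (t • b (x.shift 0) U)))) 0; topValue su2Rep L β * l2 (X Ω) (X Ω) - l2 (X Ω) (transferApply β (X Ω)) ≤ Real.sqrt (l2 (X Ω) (X Ω)) * Real.sqrt (l2 (fun U => X (transferApply β Ω) U - transferApply β (X Ω) U) (fun U => X (transferApply β Ω) U - transferApply β (X Ω) U))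

/-- ★★ **`stub_cauchySchwarzCommutator`** (registered stub of the birth skeleton of crux ⟨stmt-QuantumFields-23379⟩, signature
`CauchySchwarzCommutatorP` verbatim): `λ₀‖XΩ‖² − ⟨XΩ, K_β XΩ⟩ ≤ ‖XΩ‖·‖X(K_βΩ) − K_β(XΩ)‖`. [cite: ReedSimonIV1978, Thm. XIII.43]
[cite: Balaban1985UV3, p. 260] -/
theorem stub_cauchySchwarzCommutator : CauchySchwarzCommutatorP := by
  intro β _hβ L _ Ω hΩ _hn heig
  dsimp only
  -- the direction field at base site `x`: colour vector of the smoothed field at `x + ê₀`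
  have hB := continuous_smoothedField (L := L) (L ^ 2 * (⌈Real.log β⌉₊ + 1))
  have hdir : ∀ x : Site 3 L, Continuous fun U : GaugeConfig 3 L SU2 =>
      (EuclideanSpace.equiv (Fin 3) ℝ).symm fun a => (-(Complex.I / 2) * (pauli a *
        ((fun m : Site 3 L → Matrix (Fin 2) (Fin 2) ℂ => fun s : Site 3 L =>
          (1 / 5 : ℂ) • (m s + ∑ i ∈ ({1, 2} : Finset (Fin 3)),
            (su2Rep (U (s, i)) * m (s.shift i) * su2Rep (U (s, i))⁻¹ +
              su2Rep (U (s - Pi.single i 1, i))⁻¹ * m (s - Pi.single i 1) * su2Rep (U (s - Pi.single i 1, i)))))^[L ^ 2 * (⌈Real.log β⌉₊ + 1)]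
        (fun s : Site 3 L =>
          ((su2Rep (polyakovSite s U ((0 : Site 3 1), (1 : Fin 3)))).trace.re : ℂ) •
            ((1 / 2 : ℂ) • (su2Rep (polyakovSite s U ((0 : Site 3 1), (1 : Fin 3))) -
              su2Rep (polyakovSite s U ((0 : Site 3 1), (1 : Fin 3)))⁻¹))) (x.shift 0))).trace).re :=
    fun x => continuous_colourOf ((continuous_apply (x.shift 0)).comp hB)
  -- `ψ = XΩ` is continuous
  have hψ : Continuous fun U : GaugeConfig 3 L SU2 => ∑ x : Site 3 L, deriv (fun t : ℝ => Ω (Function.update U (x, (0 : Fin 3))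
      (U (x, (0 : Fin 3)) * expPauli (t • (EuclideanSpace.equiv (Fin 3) ℝ).symm fun a => (-(Complex.I / 2) * (pauli a *
        ((fun m : Site 3 L → Matrix (Fin 2) (Fin 2) ℂ => fun s : Site 3 L =>
          (1 / 5 : ℂ) • (m s + ∑ i ∈ ({1, 2} : Finset (Fin 3)),
            (su2Rep (U (s, i)) * m (s.shift i) * su2Rep (U (s, i))⁻¹ +
              su2Rep (U (s - Pi.single i 1, i))⁻¹ * m (s - Pi.single i 1) * su2Rep (U (s - Pi.single i 1, i)))))^[L ^ 2 * (⌈Real.log β⌉₊ + 1)]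
        (fun s : Site 3 L =>
          ((su2Rep (polyakovSite s U ((0 : Site 3 1), (1 : Fin 3)))).trace.re : ℂ) •
            ((1 / 2 : ℂ) • (su2Rep (polyakovSite s U ((0 : Site 3 1), (1 : Fin 3))) -
              su2Rep (polyakovSite s U ((0 : Site 3 1), (1 : Fin 3)))⁻¹))) (x.shift 0))).trace).re)))) 0 :=
    continuous_finsetSum _ fun x _ => continuous_deriv_vacuum_rightShift β (x, (0 : Fin 3)) (hdir x) hΩ heig
  -- abbreviate `ψ`
  set ψ : GaugeConfig 3 L SU2 → ℝ := fun U => ∑ x : Site 3 L, deriv (fun t : ℝ => Ω (Function.update U (x, (0 : Fin 3))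
      (U (x, (0 : Fin 3)) * expPauli (t • (EuclideanSpace.equiv (Fin 3) ℝ).symm fun a => (-(Complex.I / 2) * (pauli a *
        ((fun m : Site 3 L → Matrix (Fin 2) (Fin 2) ℂ => fun s : Site 3 L =>
          (1 / 5 : ℂ) • (m s + ∑ i ∈ ({1, 2} : Finset (Fin 3)),
            (su2Rep (U (s, i)) * m (s.shift i) * su2Rep (U (s, i))⁻¹ +
              su2Rep (U (s - Pi.single i 1, i))⁻¹ * m (s - Pi.single i 1) * su2Rep (U (s - Pi.single i 1, i)))))^[L ^ 2 * (⌈Real.log β⌉₊ + 1)]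
        (fun s : Site 3 L =>
          ((su2Rep (polyakovSite s U ((0 : Site 3 1), (1 : Fin 3)))).trace.re : ℂ) •
            ((1 / 2 : ℂ) • (su2Rep (polyakovSite s U ((0 : Site 3 1), (1 : Fin 3))) -
              su2Rep (polyakovSite s U ((0 : Site 3 1), (1 : Fin 3)))⁻¹))) (x.shift 0))).trace).re)))) 0 with hψ_def
  -- `X(K_βΩ) = λ₀ψ`
  have hXK : (fun U : GaugeConfig 3 L SU2 => ∑ x : Site 3 L, deriv (fun t : ℝ => transferApply β Ω (Function.update U (x, (0 : Fin 3))
      (U (x, (0 : Fin 3)) * expPauli (t • (EuclideanSpace.equiv (Fin 3) ℝ).symm fun a => (-(Complex.I / 2) * (pauli a *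
        ((fun m : Site 3 L → Matrix (Fin 2) (Fin 2) ℂ => fun s : Site 3 L =>
          (1 / 5 : ℂ) • (m s + ∑ i ∈ ({1, 2} : Finset (Fin 3)),
            (su2Rep (U (s, i)) * m (s.shift i) * su2Rep (U (s, i))⁻¹ +
              su2Rep (U (s - Pi.single i 1, i))⁻¹ * m (s - Pi.single i 1) * su2Rep (U (s - Pi.single i 1, i)))))^[L ^ 2 * (⌈Real.log β⌉₊ + 1)]
        (fun s : Site 3 L =>
          ((su2Rep (polyakovSite s U ((0 : Site 3 1), (1 : Fin 3)))).trace.re : ℂ) •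
            ((1 / 2 : ℂ) • (su2Rep (polyakovSite s U ((0 : Site 3 1), (1 : Fin 3))) -
              su2Rep (polyakovSite s U ((0 : Site 3 1), (1 : Fin 3)))⁻¹))) (x.shift 0))).trace).re)))) 0
        - transferApply β ψ U) =
      fun U => topValue su2Rep L β * ψ U - transferApply β ψ U := by
    funext U
    rw [heig, hψ_def, Finset.mul_sum]
    congr 1
    refine Finset.sum_congr rfl fun x _ => ?_
    simp only [Pi.smul_apply, smul_eq_mul]
    exact deriv_const_mul_field _
  rw [hXK]
  have hKψ : Continuous (transferApply β ψ) := continuous_transferApply_of_continuous β hψ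
  have hg : Continuous fun U => topValue su2Rep L β * ψ U - transferApply β ψ U := (continuous_const.mul hψ).sub hKψ
  -- the deficit is `⟨ψ, λ₀ψ − K_βψ⟩`
  have hdef : topValue su2Rep L β * l2 ψ ψ - l2 ψ (transferApply β ψ) = l2 ψ (fun U => topValue su2Rep L β * ψ U - transferApply β ψ U) := by
    unfold l2
    rw [← integral_const_mul, ← integral_sub ((integrable_mul_of_continuous hψ hψ).const_mul _) (integrable_mul_of_continuous hψ hKψ)]
    refine integral_congr_ae (ae_of_all _ fun U => ?_)
    dsimp only
    ring
  rw [hdef]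
  exact l2_le_sqrt_mul_sqrt_of_continuous hψ hg

end Summit.QuantumFields.YangMills.Theorems.CovariantCurrentDoor

end
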